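/-
Copyright: the b2b-balaban T⁴-continuum CRUX team, row NE7b leaf lineage `t4-ne7b-formalise-leaf-05` (gen 153). Project licence.
-/
import Mathlib.Algebra.Order.Chebyshev
import Mathlib.LinearAlgebra.Matrix.DotProduct
import Mathlib.Analysis.Normed.Field.Basic

/-!
# THE PERTURBATION LETTER `δ` OF THE (h2) SKELETON FROM A LOCAL ENTRYWISE BOUND: `Σ_p (f_p(B) − g_p(B))² ≤ η²ab‖B‖²` when every square-root functional
# differs from its flat twin by `|f_p(B) − g_p(B)| ≤ η·Σ_{c ∈ ∂p} |B(c)|` with `#∂p ≤ a` bonds per plaquette and `#{p : c ∈ ∂p} ≤ b` plaquettes per bond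
# (Cauchy–Schwarz + double counting) — SectE-interface-proof Lemma 5.5's «`|((∂_{e^{iW}} − ∂_1)B″)(P)| ≤ 4·2ε_F max_{c∈∂P}|B″(c)|` … so the
# `‖·‖`-difference of the two square-root forms is `≤ c₄ε_F‖B″‖`», i.e. `δ = c₄²ε_F²` with `c₄² = η²ab`, `η = 8ε_F`, `a = 4`, `b = 2(d−1)` (row NE7b,
# node U5c; residual (R2′) family (2), letter (ℓ1); kernel lemmas)

Cell `pub-balaban`, sub-cell `t4`, spine estimate NE7b (`T4WeightBudget.RelWeightBound`; the cell's OWN estimate — NOT PRINTED in [Bałaban 1983–89],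
NOT PROVED).  Crux-route work under `Spine/NE7b/`; NOTHING of Bałaban's is asserted; no `def`; zero `sorry`; no `T4Continuum/Support` leaf (FREEZE (0)).
Imports: Mathlib only (`Algebra.Order.Chebyshev` for `Finset.sum_mul_sq_le_sq_mul_sq`, `LinearAlgebra.Matrix.DotProduct`, `Analysis.Normed.Field.Basic`).

WHY.  `…AdmissibleFloorIMS` (this lineage, p378268 ✓) takes the (h2) proof's perturbation step as the letter (pert) `F⁰_s Y∕2 − δ‖Y‖² ≤ F′_s Y`, produced by
its `floor_of_sqrt_perturbation` from `Σ_p (f_p(B) − g_p(B))² ≤ δ‖B‖²`.  In print that bound is LOCAL: each plaquette functional at the small gauge field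
differs from the flat one by `η` times the field on the plaquette's own bonds.  THIS FILE turns «local entrywise difference» into the global letter with
`δ = η²ab` by the two counts `a` (bonds per plaquette) and `b` (plaquettes per bond) — so after `…IMSErrorLetters` (`ε` from counts) and `…AdmissibleFloorLetters`
((flat) by value, (adm) pointwise), the (h2) skeleton displays BY VALUE only: the gauge covariance identity (cov)∕(iso) and the one-plaquette size `η`
(`= 8ε_F`-type, (π8) B7 Props 1–2).

WHAT IS PROVED ([folklore]; plaquette index `P`, bond index `C`, incidence `inc : P → Finset C`):
* §1 DOUBLE COUNTING: **`sum_sq_local_le`** (`#inc(p) ≤ a`, `#{p : c ∈ inc(p)} ≤ b` ⊢ `Σ_p (Σ_{c ∈ inc p} |B(c)|)² ≤ a·b·Σ_c B(c)²`),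
  `sum_sum_mem_eq` (the swap `Σ_p Σ_{c ∈ inc p} g(c) = Σ_c #{p : c ∈ inc p}·g(c)`).
* §2 **`pert_letter_of_local`** — `|f_p(B) − g_p(B)| ≤ η·Σ_{c ∈ inc p} |B(c)|` ⊢ `Σ_p (f_p(B) − g_p(B))² ≤ η²ab·(B ⬝ᵥ B)` — VERBATIM the `hfg`
  hypothesis of `…AdmissibleFloorIMS.floor_of_sqrt_perturbation` with `δ := η²ab`; **`pert_letter_of_local_max`** — the print's `max`-form
  `|f_p(B) − g_p(B)| ≤ η·max_{c ∈ inc p}|B(c)|` implies the `Σ`-form (a `max` over a nonempty finset is `≤` the sum of nonnegatives), same `δ`.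
* §3 toy: two plaquettes sharing one of three bonds (`a = 2`, `b = 2`): the count closes (`example`).

NOT HERE (honest): `η` BY VALUE ((π8): [B7] Props 1–2 (124)∕(126), `|Ad(·) − Ad(·)| ≤ 2|· − ·|`); the lattice counts `a = 4`, `b = 2(d−1)` for unit plaquettes
(B6's carrier, not typed here); (cov)∕(iso); (A3) ∕ (A1c); NC-NE7b-α UNRULED.  BY-NAME EFFECT ON THE WALL: NONE.
NE7b NOT PRINTED ∕ NOT PROVED; spine PROVED 0∕9; rung (B)+1 on ONE finite T⁴ — NOT infinite volume, NOT the mass gap, NOT Clay.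
HONEST DEPENDENCY: continuum YM on T⁴ ⇐ BetaPertH ∧ nine spine estimates (0/9 proved); BetaPertH ⇐ (D1) ∧ (D4) ∧ CAP+tail; G-an2-4 gates asym, D1 and NE2/3/4.
-/

set_option autoImplicit false

open Matrix Finset

namespace Summit.QuantumFields.BalabanUV.T4Continuum.NE7b.SqrtFormPerturbationLetters

variable {P C : Type*} [Fintype P] [Fintype C]

/-! ## §1 Double counting along the plaquette–bond incidence -/

section Counting

/-- **THE SWAP**: `Σ_p Σ_{c ∈ inc p} g(c) = Σ_c #{p : c ∈ inc p}·g(c)`. [folklore] -/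
theorem sum_sum_mem_eq [DecidableEq C] (inc : P → Finset C) (g : C → ℝ) :
    ∑ p, ∑ c ∈ inc p, g c = ∑ c, ((Finset.univ.filter fun p => c ∈ inc p).card : ℝ) * g c := by
  classical
  have h1 : ∀ p, ∑ c ∈ inc p, g c = ∑ c, if c ∈ inc p then g c else 0 := fun p => by
    rw [← Finset.sum_filter]; congr 1; ext c; simp
  simp_rw [h1]
  rw [Finset.sum_comm]
  refine Finset.sum_congr rfl fun c _ => ?_
  rw [← Finset.sum_filter, Finset.sum_const, nsmul_eq_mul]

/-- **DOUBLE COUNTING WITH CAUCHY–SCHWARZ**: `#inc(p) ≤ a` (bonds per plaquette) and `#{p : c ∈ inc(p)} ≤ b` (plaquettes per bond) ⊢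
`Σ_p (Σ_{c ∈ inc p} |B(c)|)² ≤ a·b·Σ_c B(c)²`. [folklore] -/
theorem sum_sq_local_le [DecidableEq C] (inc : P → Finset C) (B : C → ℝ) {a b : ℕ}
    (ha : ∀ p, (inc p).card ≤ a) (hb : ∀ c, (Finset.univ.filter fun p => c ∈ inc p).card ≤ b) :
    ∑ p, (∑ c ∈ inc p, |B c|) ^ 2 ≤ a * b * ∑ c, B c ^ 2 := by
  -- Cauchy–Schwarz on each plaquette: `(Σ 1·|B c|)² ≤ #inc(p) · Σ |B c|² ≤ a Σ_{c ∈ inc p} B c²`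
  have hcs : ∀ p, (∑ c ∈ inc p, |B c|) ^ 2 ≤ a * ∑ c ∈ inc p, B c ^ 2 := by
    intro p
    have h := Finset.sum_mul_sq_le_sq_mul_sq (inc p) (fun _ => (1 : ℝ)) (fun c => |B c|)
    simp only [one_mul, one_pow, Finset.sum_const, nsmul_eq_mul, mul_one, sq_abs] at h
    exact h.trans (mul_le_mul_of_nonneg_right (by exact_mod_cast ha p) (Finset.sum_nonneg fun c _ => sq_nonneg _))
  calc ∑ p, (∑ c ∈ inc p, |B c|) ^ 2 ≤ ∑ p, (a * ∑ c ∈ inc p, B c ^ 2) := Finset.sum_le_sum fun p _ => hcs p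
    _ = a * ∑ c, ((Finset.univ.filter fun p => c ∈ inc p).card : ℝ) * B c ^ 2 := by
        rw [← Finset.mul_sum, sum_sum_mem_eq]
    _ ≤ a * ∑ c, (b : ℝ) * B c ^ 2 := by
        refine mul_le_mul_of_nonneg_left (Finset.sum_le_sum fun c _ => ?_) (Nat.cast_nonneg a)
        exact mul_le_mul_of_nonneg_right (by exact_mod_cast hb c) (sq_nonneg _)
    _ = a * b * ∑ c, B c ^ 2 := by rw [← Finset.mul_sum]; ring

end Counting

/-! ## §2 The (pert) letter `δ = η²ab` from a local entrywise bound -/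

section Pert

/-- **THE PERTURBATION LETTER FROM A LOCAL BOUND**: `|f_p(B) − g_p(B)| ≤ η·Σ_{c ∈ inc p}|B(c)|` for every plaquette `p`, counts `a`, `b` as in §1
⊢ `Σ_p (f_p(B) − g_p(B))² ≤ η²ab·(B ⬝ᵥ B)` — the `hfg` hypothesis of `…AdmissibleFloorIMS.floor_of_sqrt_perturbation` with `δ := η²ab`. [folklore] -/
theorem pert_letter_of_local [DecidableEq C] (inc : P → Finset C) (f g : P → (C → ℝ) → ℝ) {η : ℝ} {a b : ℕ}
    (ha : ∀ p, (inc p).card ≤ a) (hb : ∀ c, (Finset.univ.filter fun p => c ∈ inc p).card ≤ b)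
    (B : C → ℝ) (hloc : ∀ p, |f p B - g p B| ≤ η * ∑ c ∈ inc p, |B c|) :
    ∑ p, (f p B - g p B) ^ 2 ≤ η ^ 2 * a * b * (B ⬝ᵥ B) := by
  have h1 : ∀ p, (f p B - g p B) ^ 2 ≤ η ^ 2 * (∑ c ∈ inc p, |B c|) ^ 2 := by
    intro p
    rw [← sq_abs (f p B - g p B), ← mul_pow]
    exact pow_le_pow_left₀ (abs_nonneg _) (hloc p) 2
  have h2 := sum_sq_local_le inc B ha hb
  have h3 : B ⬝ᵥ B = ∑ c, B c ^ 2 := by simp only [dotProduct, pow_two]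
  calc ∑ p, (f p B - g p B) ^ 2 ≤ ∑ p, η ^ 2 * (∑ c ∈ inc p, |B c|) ^ 2 := Finset.sum_le_sum fun p _ => h1 p
    _ = η ^ 2 * ∑ p, (∑ c ∈ inc p, |B c|) ^ 2 := by rw [Finset.mul_sum]
    _ ≤ η ^ 2 * (a * b * ∑ c, B c ^ 2) := mul_le_mul_of_nonneg_left h2 (sq_nonneg η)
    _ = η ^ 2 * a * b * (B ⬝ᵥ B) := by rw [h3]; ring

/-- **THE PRINT's `max`-FORM**: `|f_p(B) − g_p(B)| ≤ η·max_{c ∈ inc p}|B(c)|` over NONEMPTY incidence sets (`η ≥ 0`) implies the `Σ`-form, hence the same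
letter `δ = η²ab` (the maximum of nonnegatives over a nonempty finset is at most their sum). [folklore] -/
theorem pert_letter_of_local_max [DecidableEq C] (inc : P → Finset C) (hne : ∀ p, (inc p).Nonempty)
    (f g : P → (C → ℝ) → ℝ) {η : ℝ} {a b : ℕ} (hη : 0 ≤ η)
    (ha : ∀ p, (inc p).card ≤ a) (hb : ∀ c, (Finset.univ.filter fun p => c ∈ inc p).card ≤ b)
    (B : C → ℝ) (hloc : ∀ p, |f p B - g p B| ≤ η * (inc p).sup' (hne p) fun c => |B c|) :
    ∑ p, (f p B - g p B) ^ 2 ≤ η ^ 2 * a * b * (B ⬝ᵥ B) := by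
  refine pert_letter_of_local inc f g ha hb B fun p => (hloc p).trans (mul_le_mul_of_nonneg_left ?_ hη)
  -- `max ≤ Σ` for nonnegatives
  obtain ⟨c₀, hc₀, hmax⟩ := Finset.exists_mem_eq_sup' (hne p) fun c => |B c|
  rw [hmax]
  exact Finset.single_le_sum (fun c _ => abs_nonneg (B c)) hc₀

end Pert

/-! ## §3 Toy: two plaquettes, three bonds, one shared — `a = 2`, `b = 2` -/

section Toy

/- `P = Fin 2`, `C = Fin 3`, `inc 0 = {0,1}`, `inc 1 = {1,2}`: `Σ_p (Σ_{c ∈ inc p}|B c|)² ≤ 2·2·Σ_c B c²`. -/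
example (B : Fin 3 → ℝ) :
    ∑ p : Fin 2, (∑ c ∈ (![{0, 1}, {1, 2}] : Fin 2 → Finset (Fin 3)) p, |B c|) ^ 2 ≤ (2 : ℕ) * (2 : ℕ) * ∑ c, B c ^ 2 :=
  sum_sq_local_le (![{0, 1}, {1, 2}] : Fin 2 → Finset (Fin 3)) B
    (fun p => by fin_cases p <;> decide) (fun c => by fin_cases c <;> decide)

end Toy

end Summit.QuantumFields.BalabanUV.T4Continuum.NE7b.SqrtFormPerturbationLetters
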